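import Summits.QuantumFields.BalabanUV.Beta.GAN24.VolumeLimitAlgebra

/-!
# `BalabanUV.Beta.GAN24.VolumeLimitInverse` — binder row G-an2-4 ∕ (CONV-C), route R7 «TWO CURRENCIES», PART 137: INFINITE-VOLUME LIMITS OF INVERSES OF TRANSLATION-INVARIANT TORUS OPERATORS.
# Steps (ii)+(iii) of the located route (census V177) for the ONE displayed hypothesis of PART 134, at the UNIT level and in the abstract: a volume-indexed family of SHIFT-INVARIANT matrices `A_t`
# on `Site d (side t) × Fin d` (cubic tori, `side t → ∞`) whose kernel `w ↦ A_t((w,μ),(0,ν))` (α) decays volume-uniformly in the window norm, (β) CONVERGES at every `ℤ^d` point, and (γ) has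
# `‖1 − τ•A_t‖ ≤ q < 1` uniformly (uniform coercivity + boundedness) has INVERSES whose kernels converge at every `ℤ^d` point: `(A_t)⁻¹((x̂_t,μ),(0,ν)) → s_{μν}(x)`.  Mechanism: the powers
# `(1 − τ•A_t)^i` are shift-invariant with kernels = iterated torus convolutions (power `i` bounded by `q^i`, the one-step kernel decaying), so PART 136's convolution closure gives the
# convergence of every power's kernel by induction, and PART 136's Neumann–Tannery lemma sums the series.  Consequently the effective form's hypothesis `∀ k, IsInfiniteVolumeLimit side (P k) (Π k)`
# of `conv_effForm_of_isInfiniteVolumeLimit` REDUCES to the same statement for the averaged covariance `c_k` itself (+ its shift invariance and `‖1 − τc_k‖ ≤ q`), i.e. to the fine-level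
# Green's function — step (i), the successor's (unit b2b-balaban-gan24-p3, gen 53; v1)

NOT IN PRINT; OUR PROOF ([folklore] BY NAME over PART 136 (`tendsto_inv_apply_of_tendsto_pow_apply`, `norm_pow_apply_le`), the β-cell's `Beta.InfiniteVolume` window dictionary (`windowMap`, `siteOf`,
`InWindow`, `windowMap_siteOf`, `siteOf_windowMap`, `inWindow_windowMap`, `windowMap_injective`, `eventually_inWindow`), `B12Sec2to5.summable_exp_neg_l1`, Mathlib's `tendsto_tsum_of_dominated_convergence`,
`Fintype.sum_equiv`; nothing printed is a hypothesis).
HONEST FRAMING (cell contract, verbatim): «discharging `BetaPertH` makes Bałaban's UV stability UNCONDITIONAL — a real constructive-QFT result; it is NOT the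
continuum limit and NOT the Clay problem.»  HONEST DEPENDENCY (verbatim): «continuum YM on T⁴ ⇐ BetaPertH ∧ nine spine estimates (0/9 proved); BetaPertH ⇐
(D1) ∧ (D4) ∧ CAP+tail; G-an2-4 gates asym, D1 and NE2/3/4.»

WHAT THIS FILE PROVES (0 sorry, 0 `def`; `x̂_t = (i ↦ (x i : ZMod (side t)))` the reading of `x ∈ ℤ^d`; kernels are `ℂ`-valued, convergence stated as explicit `Tendsto`):
* §1 `sum_eq_tsum_window` (a torus sum is the `ℤ^d`-`tsum` of the zero extension through the window — `ℂ`-valued twin of the β-cell's `sum_eq_tsum_windowExt`), `cast_sub_reading`;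
  **`tendsto_conv_complex`** — `P_t` bounded (`‖P‖ ≤ B`) and convergent at every reading, `Q_t` window-decaying (`‖Q t μ ν w‖ ≤ Ce^{−δ|windowMap w|₁}`, `δ > 0`) and convergent ⟹
  `Σ_λ Σ_w P t μ λ (ẑ − w)·Q t λ ν w → Σ_λ Σ'_y Pinf μ λ (z − y)·Qinf λ ν y`.
* §2 SHIFT-INVARIANT MATRICES on `Site d s × Fin d`: `shiftInv_one`, `shiftInv_sub_smul`, `shiftInv_mul`, `shiftInv_pow`, `apply_eq_kernel` (`M (x,μ) (y,ν) = M (x − y, μ) (0, ν)`),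
  **`pow_succ_apply_eq_conv`** (`(B^{i+1})((x,μ),(0,ν)) = Σ_λ Σ_w (B^i)((x − w,μ),(0,λ))·B((w,λ),(0,ν))`).
* §3 **`tendsto_pow_kernel`** (by induction: every power's kernel converges at every reading) and **`exists_tendsto_inv_kernel`** — THE THEOREM: (α)+(β)+(γ) + shift invariance ⟹
  `∀ μ ν x, ∃ s, (A_t)⁻¹((x̂_t,μ),(0,ν)) → s`; **`exists_isInfiniteVolumeLimit_inv_re`** — the β-cell predicate for the real parts: `∃ Π, IsInfiniteVolumeLimit side (t μ ν z ↦ Re (A_t)⁻¹((z,μ),(0,ν))) Π`,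
  and `exists_isInfiniteVolumeLimit_inv_sub_re` for `Re((A_t)⁻¹ − a·1)((z,μ),(0,ν))` (the effective form's shape).
WHAT IT DOES NOT DO: verify (α)(β)(γ) + shift invariance for `c_k = covBlev k` on cubic tori ((α) is PART 126 + 134's dictionary; shift invariance and (γ) from b05's `dftV` structure and
`γ_B ≤ c_k ≤ Cst`; (β) = the fine-level Green's function's volume limit = step (i)) — the successor's instance file.  SUPPLIER work; no consumer of record; NEVER «G-an2-4 closed»; NOT (CONV-C),
NOT D1, NOT `BetaPertH`, NOT continuum, NOT Clay.  Records: `HOME/b2b-balaban-gan24-p3/gen53/README.md`.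
-/

noncomputable section

open scoped BigOperators Matrix Matrix.Norms.L2Operator
open Filter Topology

namespace Summit.QuantumFields.BalabanUV.Beta.GAN24.VolumeLimitInverse

open Literature.MathematicalPhysics.QuantumFieldTheory.Balaban1983to89
open Literature.MathematicalPhysics.QuantumFieldTheory.Balaban1983to89.B12Sec2to5 (l1 summable_exp_neg_l1)
open Literature.MathematicalPhysics.QuantumFieldTheory.Balaban1983to89.Beta
  (Site windowMap siteOf InWindow IsInfiniteVolumeLimit windowMap_siteOf siteOf_windowMap inWindow_windowMap windowMap_injective eventually_inWindow)
open Summit.QuantumFields.BalabanUV.Beta.GAN24.VolumeLimitAlgebra (tendsto_inv_apply_of_tendsto_pow_apply norm_pow_apply_le)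

variable {d : ℕ}

/-! ## §1 The window re-indexing and the convolution limit for `ℂ`-valued kernels -/

section Window

/-- a torus sum is the `ℤ^d`-`tsum` of the zero extension through the window (`ℂ`-valued). [folklore] -/
theorem sum_eq_tsum_window {s : ℕ} [NeZero s] (g : Site d s → ℂ) :
    ∑ w : Site d s, g w = ∑' y : Fin d → ℤ, (if (∀ i, InWindow s (y i)) then g (siteOf d s y) else 0) := by
  have hwin : ∀ w : Site d s, (if (∀ i, InWindow s (windowMap d s w i)) then g (siteOf d s (windowMap d s w)) else 0) = g w := fun w => by
    rw [if_pos (fun i => inWindow_windowMap w i), siteOf_windowMap]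
  calc ∑ w : Site d s, g w = ∑ w : Site d s, (if (∀ i, InWindow s (windowMap d s w i)) then g (siteOf d s (windowMap d s w)) else 0) := by simp only [hwin]
    _ = ∑' w : Site d s, (if (∀ i, InWindow s (windowMap d s w i)) then g (siteOf d s (windowMap d s w)) else 0) := (tsum_fintype _).symm
    _ = ∑' y : Fin d → ℤ, (if (∀ i, InWindow s (y i)) then g (siteOf d s y) else 0) := by
        refine (windowMap_injective d s).tsum_eq (f := fun y : Fin d → ℤ => if (∀ i, InWindow s (y i)) then g (siteOf d s y) else 0) ?_
        intro y hy
        have h : ∀ i, InWindow s (y i) := by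
          by_contra hc; exact hy (if_neg hc)
        exact ⟨siteOf d s y, windowMap_siteOf d s h⟩

/-- readings commute with subtraction: `(z − y)̂ = ẑ − ŷ` in `Site d s`. [folklore] -/
theorem cast_sub_reading (s : ℕ) (z y : Fin d → ℤ) :
    (fun i => ((z - y) i : ZMod s)) = (fun i => (z i : ZMod s)) - fun i => (y i : ZMod s) := by
  funext i; push_cast [Pi.sub_apply]; ring

variable {side : ℕ → ℕ} [∀ t, NeZero (side t)]

/-- **`tendsto_conv_complex` — CONVOLUTION LIMITS, `ℂ`-VALUED** [folklore]: `side t → ∞`; `P_t` bounded by `B` and convergent at every reading to `Pinf`; `Q_t` window-decaying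
(`‖Q t μ ν w‖ ≤ C·e^{−δ|windowMap w|₁}`, `δ > 0`) and convergent to `Qinf` ⟹ for all `μ ν z`:
`Σ_λ Σ_w P t μ λ (ẑ_t − w)·Q t λ ν w → Σ_λ Σ'_y Pinf μ λ (z − y)·Qinf λ ν y` (Tannery over the window, majorant `B·C·e^{−δ|y|₁}`). -/
theorem tendsto_conv_complex (hside : Tendsto side atTop atTop) {P Q : (t : ℕ) → Fin d → Fin d → Site d (side t) → ℂ} {Pinf Qinf : Fin d → Fin d → (Fin d → ℤ) → ℂ}
    (hP : ∀ μ ν (u : Fin d → ℤ), Tendsto (fun t => P t μ ν (fun i => (u i : ZMod (side t)))) atTop (𝓝 (Pinf μ ν u)))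
    (hQ : ∀ μ ν (u : Fin d → ℤ), Tendsto (fun t => Q t μ ν (fun i => (u i : ZMod (side t)))) atTop (𝓝 (Qinf μ ν u)))
    {B C δ : ℝ} (hB : ∀ t μ ν w, ‖P t μ ν w‖ ≤ B) (hQd : ∀ t μ ν w, ‖Q t μ ν w‖ ≤ C * Real.exp (-δ * l1 (windowMap d (side t) w))) (hδ : 0 < δ)
    (μ ν : Fin d) (z : Fin d → ℤ) :
    Tendsto (fun t => ∑ l, ∑ w : Site d (side t), P t μ l ((fun i => (z i : ZMod (side t))) - w) * Q t l ν w) atTop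
      (𝓝 (∑ l, ∑' y : Fin d → ℤ, Pinf μ l (z - y) * Qinf l ν y)) := by
  classical
  refine tendsto_finsetSum _ fun l _ => ?_
  have hB0 : 0 ≤ B := (norm_nonneg _).trans (hB 0 μ l 0)
  have hC0 : 0 ≤ C := by
    have h := hQd 0 l ν 0
    have : (0 : ℝ) ≤ C * Real.exp (-δ * l1 (windowMap d (side 0) 0)) := (norm_nonneg _).trans h
    exact nonneg_of_mul_nonneg_left this (Real.exp_pos _)
  simp_rw [sum_eq_tsum_window]
  refine tendsto_tsum_of_dominated_convergence ((summable_exp_neg_l1 hδ d).mul_left (B * C)) (fun y => ?_) (Eventually.of_forall fun t y => ?_)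
  · have hxy : (fun t => P t μ l ((fun i => (z i : ZMod (side t))) - fun i => (y i : ZMod (side t))) * Q t l ν (fun i => (y i : ZMod (side t))))
        =ᶠ[atTop] fun t => (if (∀ i, InWindow (side t) (y i)) then
          P t μ l ((fun i => (z i : ZMod (side t))) - siteOf d (side t) y) * Q t l ν (siteOf d (side t) y) else 0) := by
      filter_upwards [eventually_inWindow hside y] with t ht
      rw [if_pos ht]; rfl
    refine Tendsto.congr' hxy ?_
    have h1 : Tendsto (fun t => P t μ l ((fun i => (z i : ZMod (side t))) - fun i => (y i : ZMod (side t)))) atTop (𝓝 (Pinf μ l (z - y))) :=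
      (hP μ l (z - y)).congr' (Eventually.of_forall fun t => by rw [cast_sub_reading])
    exact h1.mul (hQ l ν y)
  · by_cases hy : ∀ i, InWindow (side t) (y i)
    · rw [if_pos hy, norm_mul]
      have h2 := hQd t l ν (siteOf d (side t) y)
      rw [windowMap_siteOf d (side t) hy] at h2
      calc ‖P t μ l _‖ * ‖Q t l ν (siteOf d (side t) y)‖ ≤ B * (C * Real.exp (-δ * l1 y)) := mul_le_mul (hB t μ l _) h2 (norm_nonneg _) hB0
        _ = B * C * Real.exp (-δ * l1 y) := by ring
    · rw [if_neg hy, norm_zero]; positivity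

end Window

/-! ## §2 Shift-invariant matrices on `Site d s × Fin d`: products, powers, kernels -/

section Shift

variable {s : ℕ} [NeZero s]

omit [NeZero s] in
/-- the identity is shift-invariant. [folklore] -/
theorem shiftInv_one (x : Site d s) (μ : Fin d) (y : Site d s) (ν : Fin d) (v : Site d s) :
    (1 : Matrix (Site d s × Fin d) (Site d s × Fin d) ℂ) (x + v, μ) (y + v, ν) = (1 : Matrix (Site d s × Fin d) (Site d s × Fin d) ℂ) (x, μ) (y, ν) := by
  simp only [Matrix.one_apply, Prod.mk.injEq, add_left_inj]

omit [NeZero s] in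
/-- `1 − τ•A` is shift-invariant when `A` is. [folklore] -/
theorem shiftInv_sub_smul {A : Matrix (Site d s × Fin d) (Site d s × Fin d) ℂ} (hA : ∀ x μ y ν v, A (x + v, μ) (y + v, ν) = A (x, μ) (y, ν)) (τ : ℂ)
    (x : Site d s) (μ : Fin d) (y : Site d s) (ν : Fin d) (v : Site d s) :
    (1 - τ • A) (x + v, μ) (y + v, ν) = (1 - τ • A) (x, μ) (y, ν) := by
  simp only [Matrix.sub_apply, Matrix.smul_apply, shiftInv_one, hA]

/-- products of shift-invariant matrices are shift-invariant (re-index the middle sum by the shift). [folklore] -/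
theorem shiftInv_mul {A B : Matrix (Site d s × Fin d) (Site d s × Fin d) ℂ} (hA : ∀ x μ y ν v, A (x + v, μ) (y + v, ν) = A (x, μ) (y, ν))
    (hB : ∀ x μ y ν v, B (x + v, μ) (y + v, ν) = B (x, μ) (y, ν)) (x : Site d s) (μ : Fin d) (y : Site d s) (ν : Fin d) (v : Site d s) :
    (A * B) (x + v, μ) (y + v, ν) = (A * B) (x, μ) (y, ν) := by
  rw [Matrix.mul_apply, Matrix.mul_apply]
  refine Fintype.sum_equiv ((Equiv.subRight v).prodCongr (Equiv.refl (Fin d))) _ _ fun p => ?_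
  rcases p with ⟨w, l⟩
  simp only [Equiv.prodCongr_apply, Equiv.coe_refl, Prod.map_apply, Equiv.subRight_apply, id_eq]
  have e1 : A (x + v, μ) (w, l) = A (x, μ) (w - v, l) := by
    have := hA x μ (w - v) l v; rwa [sub_add_cancel] at this
  have e2 : B (w, l) (y + v, ν) = B (w - v, l) (y, ν) := by
    have := hB (w - v) l y ν v; rwa [sub_add_cancel] at this
  rw [e1, e2]

/-- powers of a shift-invariant matrix are shift-invariant. [folklore] -/
theorem shiftInv_pow {B : Matrix (Site d s × Fin d) (Site d s × Fin d) ℂ} (hB : ∀ x μ y ν v, B (x + v, μ) (y + v, ν) = B (x, μ) (y, ν)) :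
    ∀ (i : ℕ) (x : Site d s) (μ : Fin d) (y : Site d s) (ν : Fin d) (v : Site d s), (B ^ i) (x + v, μ) (y + v, ν) = (B ^ i) (x, μ) (y, ν) := by
  intro i
  induction i with
  | zero => intro x μ y ν v; rw [pow_zero]; exact shiftInv_one x μ y ν v
  | succ i ih => intro x μ y ν v; rw [pow_succ]; exact shiftInv_mul ih hB x μ y ν v

omit [NeZero s] in
/-- a shift-invariant matrix is a kernel of the difference: `M (x,μ) (y,ν) = M (x − y, μ) (0, ν)`. [folklore] -/
theorem apply_eq_kernel {M : Matrix (Site d s × Fin d) (Site d s × Fin d) ℂ} (hM : ∀ x μ y ν v, M (x + v, μ) (y + v, ν) = M (x, μ) (y, ν))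
    (x : Site d s) (μ : Fin d) (y : Site d s) (ν : Fin d) : M (x, μ) (y, ν) = M (x - y, μ) (0, ν) := by
  have := hM (x - y) μ 0 ν y
  rwa [sub_add_cancel, zero_add] at this

/-- **the kernel of the next power is the torus convolution of the power's kernel with the one-step kernel**:
`(B^{i+1})((x,μ),(0,ν)) = Σ_λ Σ_w (B^i)((x − w,μ),(0,λ))·B((w,λ),(0,ν))`. [folklore] -/
theorem pow_succ_apply_eq_conv {B : Matrix (Site d s × Fin d) (Site d s × Fin d) ℂ} (hB : ∀ x μ y ν v, B (x + v, μ) (y + v, ν) = B (x, μ) (y, ν)) (i : ℕ)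
    (x : Site d s) (μ ν : Fin d) :
    (B ^ (i + 1)) (x, μ) (0, ν) = ∑ l, ∑ w : Site d s, (B ^ i) (x - w, μ) (0, l) * B (w, l) (0, ν) := by
  rw [pow_succ, Matrix.mul_apply, Fintype.sum_prod_type, Finset.sum_comm]
  refine Finset.sum_congr rfl fun l _ => Finset.sum_congr rfl fun w _ => ?_
  rw [apply_eq_kernel (shiftInv_pow hB i) x μ w l]

end Shift

/-! ## §3 Every power's kernel converges; hence the inverse's kernel converges -/

section Inverse

variable {side : ℕ → ℕ} [∀ t, NeZero (side t)]

/-- **`tendsto_pow_kernel`** [folklore]: `side t → ∞`; `A_t` shift-invariant with `‖1 − τ•A_t‖ ≤ q ≤ 1`, kernel decay `‖A_t((w,μ),(0,ν))‖ ≤ C·e^{−δ|windowMap w|₁}` (`δ > 0`) and kernel convergence at every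
reading ⟹ for every `i` there is a limit kernel `G` with `((1 − τ•A_t)^i)((x̂_t,μ),(0,ν)) → G μ ν x` for all `μ ν x` (induction: PART 136's bound `q^i ≤ 1` for the power, the one-step kernel
`δ − τK` decays, §1's convolution limit). -/
theorem tendsto_pow_kernel (hside : Tendsto side atTop atTop) {A : (t : ℕ) → Matrix (Site d (side t) × Fin d) (Site d (side t) × Fin d) ℂ} {τ : ℂ} {q C δ : ℝ}
    (hq : ∀ t, ‖1 - τ • A t‖ ≤ q) (hq1 : q ≤ 1) (hshift : ∀ t x μ y ν v, A t (x + v, μ) (y + v, ν) = A t (x, μ) (y, ν))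
    (hdec : ∀ t μ ν (w : Site d (side t)), ‖A t (w, μ) (0, ν)‖ ≤ C * Real.exp (-δ * l1 (windowMap d (side t) w))) (hδ : 0 < δ)
    {Kinf : Fin d → Fin d → (Fin d → ℤ) → ℂ} (hlim : ∀ μ ν (x : Fin d → ℤ), Tendsto (fun t => A t ((fun i => (x i : ZMod (side t))), μ) (0, ν)) atTop (𝓝 (Kinf μ ν x)))
    (i : ℕ) : ∃ G : Fin d → Fin d → (Fin d → ℤ) → ℂ, ∀ μ ν (x : Fin d → ℤ),
      Tendsto (fun t => ((1 - τ • A t) ^ i : Matrix _ _ ℂ) ((fun i => (x i : ZMod (side t))), μ) (0, ν)) atTop (𝓝 (G μ ν x)) := by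
  classical
  induction i with
  | zero =>
    refine ⟨fun μ ν x => if x = 0 ∧ μ = ν then 1 else 0, fun μ ν x => ?_⟩
    simp only [pow_zero]
    refine tendsto_const_nhds.congr' ?_
    filter_upwards [eventually_inWindow hside x, eventually_inWindow hside 0] with t hx h0
    have key : ((fun i => (x i : ZMod (side t))) = 0) ↔ x = 0 := by
      constructor
      · intro h
        have e1 : windowMap d (side t) (siteOf d (side t) x) = x := windowMap_siteOf d (side t) hx
        have e2 : siteOf d (side t) x = siteOf d (side t) 0 := by
          funext i; have := congrFun h i; simpa [siteOf] using this
        rw [e2, windowMap_siteOf d (side t) h0] at e1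
        exact e1.symm
      · rintro rfl; funext i; simp
    rw [Matrix.one_apply]
    simp only [Prod.mk.injEq, key]
  | succ i ih =>
    obtain ⟨G, hG⟩ := ih
    -- the one-step kernel `B_t((w,λ),(0,ν))`, `B_t = 1 − τ•A_t`: decays and converges
    have hBshift : ∀ t x μ y ν v, (1 - τ • A t) (x + v, μ) (y + v, ν) = (1 - τ • A t) (x, μ) (y, ν) := fun t => shiftInv_sub_smul (hshift t) τ
    have hBdec : ∀ t μ ν (w : Site d (side t)), ‖(1 - τ • A t) (w, μ) (0, ν)‖ ≤ (1 + ‖τ‖ * C) * Real.exp (-δ * l1 (windowMap d (side t) w)) := by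
      intro t μ ν w
      rw [Matrix.sub_apply, Matrix.smul_apply, smul_eq_mul]
      refine (norm_sub_le _ _).trans ?_
      rw [norm_mul, add_mul, one_mul]
      refine add_le_add ?_ (by rw [mul_assoc]; exact mul_le_mul_of_nonneg_left (hdec t μ ν w) (norm_nonneg _))
      have hC0 : 0 ≤ C := nonneg_of_mul_nonneg_left ((norm_nonneg _).trans (hdec t μ ν w)) (Real.exp_pos _)
      by_cases h : ((w, μ) : Site d (side t) × Fin d) = ((0 : Site d (side t)), ν)
      · have hw : w = 0 := congrArg Prod.fst h
        rw [h, Matrix.one_apply_eq, norm_one, hw]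
        have : l1 (windowMap d (side t) (0 : Site d (side t))) = 0 := by
          have h0 : windowMap d (side t) (siteOf d (side t) (0 : Fin d → ℤ)) = 0 :=
            windowMap_siteOf d (side t) fun i => Beta.inWindow_of_two_mul_abs_lt (by
              have := Nat.pos_of_ne_zero (NeZero.ne (side t)); simp only [Pi.zero_apply, abs_zero, mul_zero]; exact_mod_cast this)
          have e : siteOf d (side t) (0 : Fin d → ℤ) = 0 := by funext i; simp [siteOf]
          rw [e] at h0; rw [h0]; simp [l1]
        rw [this, mul_zero, Real.exp_zero]
      · rw [Matrix.one_apply_ne h, norm_zero]; positivity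
    have hBlim : ∀ μ ν (x : Fin d → ℤ), Tendsto (fun t => (1 - τ • A t) ((fun i => (x i : ZMod (side t))), μ) (0, ν)) atTop
        (𝓝 ((if x = 0 ∧ μ = ν then 1 else 0) - τ * Kinf μ ν x)) := by
      intro μ ν x
      have h1 : Tendsto (fun t => (1 : Matrix (Site d (side t) × Fin d) (Site d (side t) × Fin d) ℂ) ((fun i => (x i : ZMod (side t))), μ) (0, ν)) atTop
          (𝓝 (if x = 0 ∧ μ = ν then 1 else 0)) := by
        refine tendsto_const_nhds.congr' ?_
        filter_upwards [eventually_inWindow hside x, eventually_inWindow hside 0] with t hx h0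
        have key : ((fun i => (x i : ZMod (side t))) = 0) ↔ x = 0 := by
          constructor
          · intro h
            have e1 : windowMap d (side t) (siteOf d (side t) x) = x := windowMap_siteOf d (side t) hx
            have e2 : siteOf d (side t) x = siteOf d (side t) 0 := by
              funext i; have := congrFun h i; simpa [siteOf] using this
            rw [e2, windowMap_siteOf d (side t) h0] at e1
            exact e1.symm
          · rintro rfl; funext i; simp
        rw [Matrix.one_apply]; simp only [Prod.mk.injEq, key]
      have h2 := ((hlim μ ν x).const_mul τ)
      have := h1.sub h2
      refine this.congr (fun t => ?_)
      rw [Matrix.sub_apply, Matrix.smul_apply, smul_eq_mul]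
    -- the power's kernel: bounded by `q^i ≤ 1`, convergent by the induction hypothesis
    have hPb : ∀ t μ l (w : Site d (side t)), ‖((1 - τ • A t) ^ i : Matrix _ _ ℂ) (w, μ) (0, l)‖ ≤ 1 := fun t μ l w =>
      (norm_pow_apply_le (hq t) i _ _).trans (pow_le_one₀ ((norm_nonneg _).trans (hq t)) hq1)
    refine ⟨fun μ ν x => ∑ l, ∑' y : Fin d → ℤ, G μ l (x - y) * ((if y = 0 ∧ l = ν then 1 else 0) - τ * Kinf l ν y), fun μ ν x => ?_⟩
    have hconv := tendsto_conv_complex hside (P := fun t μ l w => ((1 - τ • A t) ^ i : Matrix _ _ ℂ) (w, μ) (0, l))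
      (Q := fun t l ν w => (1 - τ • A t) (w, l) (0, ν)) hG hBlim hPb hBdec hδ μ ν x
    refine hconv.congr (fun t => ?_)
    rw [pow_succ_apply_eq_conv (hBshift t) i]

/-- **`exists_tendsto_inv_kernel` — INFINITE-VOLUME LIMITS OF THE INVERSE KERNELS** [our proof]: cubic tori `side t → ∞`; shift-invariant `A_t` on `Site d (side t) × Fin d` with (γ) `‖1 − τ•A_t‖ ≤ q < 1`,
(α) `‖A_t((w,μ),(0,ν))‖ ≤ C·e^{−δ|windowMap w|₁}` (`δ > 0`) and (β) `A_t((x̂_t,μ),(0,ν)) → K_∞(μ,ν,x)` for every `x ∈ ℤ^d` ⟹ for all `μ ν x` the inverse kernels converge: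
`∃ s, (A_t)⁻¹((x̂_t,μ),(0,ν)) → s` (`= τ·Σ' i, G_i μ ν x`; §3 + PART 136's Neumann–Tannery). -/
theorem exists_tendsto_inv_kernel (hside : Tendsto side atTop atTop) {A : (t : ℕ) → Matrix (Site d (side t) × Fin d) (Site d (side t) × Fin d) ℂ} {τ : ℂ} {q C δ : ℝ}
    (hq : ∀ t, ‖1 - τ • A t‖ ≤ q) (hq1 : q < 1) (hshift : ∀ t x μ y ν v, A t (x + v, μ) (y + v, ν) = A t (x, μ) (y, ν))
    (hdec : ∀ t μ ν (w : Site d (side t)), ‖A t (w, μ) (0, ν)‖ ≤ C * Real.exp (-δ * l1 (windowMap d (side t) w))) (hδ : 0 < δ)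
    {Kinf : Fin d → Fin d → (Fin d → ℤ) → ℂ} (hlim : ∀ μ ν (x : Fin d → ℤ), Tendsto (fun t => A t ((fun i => (x i : ZMod (side t))), μ) (0, ν)) atTop (𝓝 (Kinf μ ν x)))
    (μ ν : Fin d) (x : Fin d → ℤ) :
    ∃ s : ℂ, Tendsto (fun t => (A t)⁻¹ ((fun i => (x i : ZMod (side t))), μ) (0, ν)) atTop (𝓝 s) := by
  have hpow := fun i => tendsto_pow_kernel hside hq hq1.le hshift hdec hδ hlim i
  choose G hG using hpow
  obtain ⟨-, h⟩ := tendsto_inv_apply_of_tendsto_pow_apply (ι := fun t => Site d (side t) × Fin d) hq1 hq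
    (fun t => ((fun i => (x i : ZMod (side t))), μ)) (fun t => ((0 : Site d (side t)), ν)) (p := fun i => G i μ ν x) (fun i => hG i μ ν x)
  exact ⟨_, h⟩

/-- **`exists_isInfiniteVolumeLimit_inv_re` — THE β-CELL PREDICATE FOR THE REAL PARTS** [our proof]: under the hypotheses of `exists_tendsto_inv_kernel`,
`∃ Π, IsInfiniteVolumeLimit side (t μ ν z ↦ Re (A_t)⁻¹((z,μ),(0,ν))) Π`. -/
theorem exists_isInfiniteVolumeLimit_inv_re (hside : Tendsto side atTop atTop) {A : (t : ℕ) → Matrix (Site d (side t) × Fin d) (Site d (side t) × Fin d) ℂ} {τ : ℂ} {q C δ : ℝ}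
    (hq : ∀ t, ‖1 - τ • A t‖ ≤ q) (hq1 : q < 1) (hshift : ∀ t x μ y ν v, A t (x + v, μ) (y + v, ν) = A t (x, μ) (y, ν))
    (hdec : ∀ t μ ν (w : Site d (side t)), ‖A t (w, μ) (0, ν)‖ ≤ C * Real.exp (-δ * l1 (windowMap d (side t) w))) (hδ : 0 < δ)
    {Kinf : Fin d → Fin d → (Fin d → ℤ) → ℂ} (hlim : ∀ μ ν (x : Fin d → ℤ), Tendsto (fun t => A t ((fun i => (x i : ZMod (side t))), μ) (0, ν)) atTop (𝓝 (Kinf μ ν x))) :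
    ∃ Pinf : B12Beta.Kernel d, IsInfiniteVolumeLimit side (fun t μ ν (z : Site d (side t)) => ((A t)⁻¹ (z, μ) (0, ν)).re) Pinf := by
  have h := fun μ ν x => exists_tendsto_inv_kernel hside hq hq1 hshift hdec hδ hlim μ ν x
  choose s hs using h
  exact ⟨fun μ ν x => (s μ ν x).re, fun μ ν x => (Complex.continuous_re.tendsto _).comp (hs μ ν x)⟩

/-- … and for `Re((A_t)⁻¹ − a·1)((z,μ),(0,ν))` — the effective form's shape `Σ = c⁻¹ − a·1`. [our proof] -/
theorem exists_isInfiniteVolumeLimit_inv_sub_re (hside : Tendsto side atTop atTop) {A : (t : ℕ) → Matrix (Site d (side t) × Fin d) (Site d (side t) × Fin d) ℂ} {τ : ℂ} {q C δ : ℝ}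
    (hq : ∀ t, ‖1 - τ • A t‖ ≤ q) (hq1 : q < 1) (hshift : ∀ t x μ y ν v, A t (x + v, μ) (y + v, ν) = A t (x, μ) (y, ν))
    (hdec : ∀ t μ ν (w : Site d (side t)), ‖A t (w, μ) (0, ν)‖ ≤ C * Real.exp (-δ * l1 (windowMap d (side t) w))) (hδ : 0 < δ)
    {Kinf : Fin d → Fin d → (Fin d → ℤ) → ℂ} (hlim : ∀ μ ν (x : Fin d → ℤ), Tendsto (fun t => A t ((fun i => (x i : ZMod (side t))), μ) (0, ν)) atTop (𝓝 (Kinf μ ν x)))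
    (a : ℂ) :
    ∃ Pinf : B12Beta.Kernel d, IsInfiniteVolumeLimit side
      (fun t μ ν (z : Site d (side t)) => (((A t)⁻¹ - a • (1 : Matrix (Site d (side t) × Fin d) (Site d (side t) × Fin d) ℂ)) (z, μ) (0, ν)).re) Pinf := by
  have h := fun μ ν x => exists_tendsto_inv_kernel hside hq hq1 hshift hdec hδ hlim μ ν x
  choose s hs using h
  refine ⟨fun μ ν x => (s μ ν x - a * (if x = 0 ∧ μ = ν then 1 else 0)).re, fun μ ν x => ?_⟩
  have h1 : Tendsto (fun t => (1 : Matrix (Site d (side t) × Fin d) (Site d (side t) × Fin d) ℂ) ((fun i => (x i : ZMod (side t))), μ) (0, ν)) atTop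
      (𝓝 (if x = 0 ∧ μ = ν then 1 else 0)) := by
    refine tendsto_const_nhds.congr' ?_
    filter_upwards [eventually_inWindow hside x, eventually_inWindow hside 0] with t hx h0
    have key : ((fun i => (x i : ZMod (side t))) = 0) ↔ x = 0 := by
      constructor
      · intro h
        have e1 : windowMap d (side t) (siteOf d (side t) x) = x := windowMap_siteOf d (side t) hx
        have e2 : siteOf d (side t) x = siteOf d (side t) 0 := by
          funext i; have := congrFun h i; simpa [siteOf] using this
        rw [e2, windowMap_siteOf d (side t) h0] at e1
        exact e1.symm
      · rintro rfl; funext i; simp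
    rw [Matrix.one_apply]; simp only [Prod.mk.injEq, key]
  have h2 := ((hs μ ν x).sub (h1.const_mul a))
  refine ((Complex.continuous_re.tendsto _).comp h2).congr (fun t => ?_)
  simp only [Function.comp_apply, Matrix.sub_apply, Matrix.smul_apply, smul_eq_mul]

end Inverse

end Summit.QuantumFields.BalabanUV.Beta.GAN24.VolumeLimitInverse

end
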